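import Literature.AlgebraicGeometry.RealAlgebraic.ComplexOrientationFormulaProofs
import Literature.FieldTheory.AlgClosed.PuiseuxImplicitRoot
import Literature.Analysis.Complex.AnalyticFormalRoots
import Mathlib.RingTheory.Localization.Integral
import HarnessLib

/-!
# Sheets of a rational plane curve over the `ξ`-line (for Rokhlin's formula, layer 5)

Sibling proof file of `ComplexOrientationFormula.lean` / `ComplexOrientationFormulaProofs.lean`
(topic `Literature/AlgebraicGeometry/RealAlgebraic`). Everything here is PROVED; no definition
and no named fact is introduced.

For a monic `Q ∈ ℚ[ξ][Y]` of `Y`-degree `d ≥ 1`, irreducible over `ℂ` (in the application: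
the sheared and normalised defining polynomial `p(ξ + cY, Y)/a` of a real plane curve,
`ComplexOrientationFormulaProofs.ShearMonic`), we record the structure of its fibres
`Y ↦ Q(ξ₀, Y)` over `ξ₀ ∈ ℂ`:

* `exists_mul_add_mul_derivative_eq_C` — a Bézout identity `A Q + B ∂_Y Q = g(ξ)` with
  `0 ≠ g ∈ ℚ[ξ]` (`Q` is separable over `ℚ(ξ)`; clear denominators), so that off the finite set
  `{g = 0}` all fibre roots are simple (`aeval_eq_zero_of_isRoot_of_isRoot_derivative`);
* `exists_localSheets` — near such a `ξ₀` the `d` roots are `d` holomorphic functions of `ξ`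
  (holomorphic implicit function theorem, the tree's `exists_holomorphic_root`), pairwise
  distinct, exhausting the root multiset;
* `exists_differentiableOn_eqOn_of_finset` — finitely many bounded singularities of a
  holomorphic function are removable (Riemann; Mathlib's
  `Complex.differentiableOn_update_limUnder_of_bddAbove`, iterated).

[folklore]

## References

* E. Brieskorn, H. Knörrer, *Plane Algebraic Curves* (1986), §8.3. [folklore]
* L. V. Ahlfors, *Complex Analysis*, 3rd ed. (1979), Ch. 4 §3.1 (removable singularities),
  Ch. 8 §2 (algebraic functions). [folklore]
-/

noncomputable section

open Polynomial Set Filter Metric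
open scoped _root_.Topology

namespace Literature.AlgebraicGeometry.RealAlgebraic

namespace Sheets

/-! ### Bézout: off finitely many `ξ₀` all fibre roots are simple -/

/-- **Bézout identity for `Q` and `∂_Y Q`.** For `Q ∈ ℚ[ξ][Y]` monic and irreducible over `ℂ`
there are `A, B ∈ ℚ[ξ][Y]` and `0 ≠ g ∈ ℚ[ξ]` with `A Q + B ∂_Y Q = g`: `Q` is irreducible over
`ℚ[ξ]`, hence over `ℚ(ξ)` (Gauss), hence separable there (characteristic `0`), and the Bézout
identity over `ℚ(ξ)` is cleared of denominators. [folklore] -/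
theorem exists_mul_add_mul_derivative_eq_C {Q : ℚ[X][X]} (hmonic : Q.Monic)
    (hirr : Irreducible (Q.map (mapRingHom (algebraMap ℚ ℂ)))) :
    ∃ g : ℚ[X], g ≠ 0 ∧ ∃ A B : ℚ[X][X], A * Q + B * derivative Q = C g := by
  have hirrQ : Irreducible Q :=
    hmonic.irreducible_of_irreducible_map (mapRingHom (algebraMap ℚ ℂ)) Q hirr
  have hprim : Q.IsPrimitive := hmonic.isPrimitive
  have hirrK : Irreducible (Q.map (algebraMap ℚ[X] (RatFunc ℚ))) :=
    (hprim.irreducible_iff_irreducible_map_fraction_map (K := RatFunc ℚ)).1 hirrQ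
  have hsep : (Q.map (algebraMap ℚ[X] (RatFunc ℚ))).Separable :=
    PerfectField.separable_of_irreducible hirrK
  obtain ⟨u, w, huw⟩ := hsep
  rw [derivative_map] at huw
  -- clear denominators
  have hclear : ∀ v : (RatFunc ℚ)[X], ∃ b : ℚ[X], b ≠ 0 ∧ ∃ V : ℚ[X][X],
      V.map (algebraMap ℚ[X] (RatFunc ℚ)) = C (algebraMap ℚ[X] (RatFunc ℚ) b) * v := by
    intro v
    obtain ⟨b, hbM, hb⟩ := IsLocalization.integerNormalization_spec (nonZeroDivisors ℚ[X]) v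
    refine ⟨b, nonZeroDivisors.ne_zero hbM,
      IsLocalization.integerNormalization (nonZeroDivisors ℚ[X]) v, ?_⟩
    rw [hb, Algebra.smul_def, Polynomial.algebraMap_apply]
  obtain ⟨bu, hbu0, U, hU⟩ := hclear u
  obtain ⟨bw, hbw0, W, hW⟩ := hclear w
  refine ⟨bu * bw, mul_ne_zero hbu0 hbw0, C bw * U, C bu * W, ?_⟩
  apply Polynomial.map_injective (algebraMap ℚ[X] (RatFunc ℚ))
    (IsFractionRing.injective ℚ[X] (RatFunc ℚ))
  simp only [Polynomial.map_add, Polynomial.map_mul, Polynomial.map_C, map_mul]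
  rw [hU, hW]
  linear_combination
    (C (algebraMap ℚ[X] (RatFunc ℚ) bu) * C (algebraMap ℚ[X] (RatFunc ℚ) bw)) * huw

/-- A common root of the fibre `Q(ξ₀, ·)` and of `∂_Y Q(ξ₀, ·)` forces `g(ξ₀) = 0` in a Bézout
identity `A Q + B ∂_Y Q = g`. [folklore] -/
theorem aeval_eq_zero_of_isRoot_of_isRoot_derivative {Q A B : ℚ[X][X]} {g : ℚ[X]}
    (h : A * Q + B * derivative Q = C g) {ξ₀ y : ℂ}
    (hy : (Q.map (eval₂RingHom (algebraMap ℚ ℂ) ξ₀)).IsRoot y)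
    (hy' : (derivative (Q.map (eval₂RingHom (algebraMap ℚ ℂ) ξ₀))).IsRoot y) :
    Polynomial.aeval ξ₀ g = 0 := by
  have h1 := congrArg (fun P : ℚ[X][X] => (P.map (eval₂RingHom (algebraMap ℚ ℂ) ξ₀)).eval y) h
  simp only [Polynomial.map_add, Polynomial.map_mul, eval_add, eval_mul, Polynomial.map_C, eval_C,
    coe_eval₂RingHom] at h1
  rw [derivative_map] at hy'
  rw [hy.eq_zero, hy'.eq_zero, mul_zero, mul_zero, add_zero] at h1
  rw [Polynomial.aeval_def, ← h1]

/-! ### Finitely many bounded singularities are removable -/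

/-- **Removable singularities, finitely many at once.** A function holomorphic on an open set
`U` off a finite set `T`, and bounded near each point of `T`, agrees off `T` with a function
holomorphic on all of `U`. [folklore] -/
theorem exists_differentiableOn_eqOn_of_finset {U : Set ℂ} (hU : IsOpen U) (T : Finset ℂ)
    {f : ℂ → ℂ} (hf : DifferentiableOn ℂ f (U \ ↑T))
    (hb : ∀ c ∈ T, ∃ M : ℝ, ∃ s ∈ 𝓝 c, ∀ z ∈ s, z ∉ T → ‖f z‖ ≤ M) :
    ∃ F : ℂ → ℂ, DifferentiableOn ℂ F U ∧ ∀ z ∈ U, z ∉ T → F z = f z := by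
  classical
  induction T using Finset.induction_on generalizing f with
  | empty => exact ⟨f, by simpa using hf, fun z _ _ => rfl⟩
  | insert c T hcT ih =>
    -- remove the singularity at `c`
    set f₁ : ℂ → ℂ := Function.update f c (limUnder (𝓝[≠] c) f) with hf₁
    have hf₁_eq : ∀ z, z ≠ c → f₁ z = f z := fun z hz => by
      rw [hf₁, Function.update_of_ne hz]
    -- `f₁` is differentiable on `U \ T`
    have hT_closed : IsClosed (↑T : Set ℂ) := T.finite_toSet.isClosed
    have hdiff₁ : DifferentiableOn ℂ f₁ (U \ ↑T) := by
      intro z hz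
      by_cases hzc : z = c
      · subst hzc
        by_cases hcU : z ∈ U
        swap; · exact absurd hz.1 hcU
        -- a small disc around `c` inside `U`, avoiding `T`, on which `f` is bounded
        obtain ⟨M, s, hs, hM⟩ := hb z (Finset.mem_insert_self z T)
        have hopen : U \ ↑T ∈ 𝓝 z := (hU.sdiff hT_closed).mem_nhds hz
        obtain ⟨δ, hδ, hball⟩ := Metric.mem_nhds_iff.1 (Filter.inter_mem hopen hs)
        have hd : DifferentiableOn ℂ f (ball z δ \ {z}) := by
          refine hf.mono fun x hx => ⟨(hball hx.1).1.1, ?_⟩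
          rintro (hxT : x ∈ (↑(insert z T) : Set ℂ))
          rw [Finset.coe_insert, Set.mem_insert_iff] at hxT
          rcases hxT with hxz | hxT
          · exact hx.2 hxz
          · exact (hball hx.1).1.2 hxT
        have hbdd : BddAbove (norm ∘ f '' (ball z δ \ {z})) := by
          refine ⟨M, ?_⟩
          rintro _ ⟨x, hx, rfl⟩
          refine hM x (hball hx.1).2 ?_
          intro hxT
          rcases Finset.mem_insert.1 hxT with hxz | hxT
          · exact hx.2 hxz
          · exact (hball hx.1).1.2 hxT
        have h := Complex.differentiableOn_update_limUnder_of_bddAbove (ball_mem_nhds z hδ) hd hbdd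
        exact (h.differentiableAt (ball_mem_nhds z hδ)).differentiableWithinAt
      · -- near `z ≠ c`, `f₁ = f`
        have hz' : z ∈ U \ ↑(insert c T) := by
          refine ⟨hz.1, ?_⟩
          rw [Finset.coe_insert, Set.mem_insert_iff]
          rintro (h | h)
          · exact hzc h
          · exact hz.2 h
        have hopen : IsOpen (U \ ↑(insert c T)) := hU.sdiff (insert c T).finite_toSet.isClosed
        have hfd : DifferentiableAt ℂ f z := hf.differentiableAt (hopen.mem_nhds hz')
        have hev : f₁ =ᶠ[𝓝 z] f := by
          filter_upwards [isOpen_ne.mem_nhds hzc] with x hx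
          exact hf₁_eq x hx
        exact (hev.differentiableAt_iff.2 hfd).differentiableWithinAt
    -- `f₁` is bounded near the remaining singular points
    have hb₁ : ∀ c' ∈ T, ∃ M : ℝ, ∃ s ∈ 𝓝 c', ∀ z ∈ s, z ∉ T → ‖f₁ z‖ ≤ M := by
      intro c' hc'
      obtain ⟨M, s, hs, hM⟩ := hb c' (Finset.mem_insert_of_mem hc')
      have hne : c' ≠ c := fun h => hcT (h ▸ hc')
      refine ⟨M, s ∩ {z | z ≠ c}, Filter.inter_mem hs (isOpen_ne.mem_nhds hne), fun z hz hzT => ?_⟩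
      rw [hf₁_eq z hz.2]
      exact hM z hz.1 fun h => (Finset.mem_insert.1 h).elim hz.2 hzT
    obtain ⟨F, hF, hFeq⟩ := ih hdiff₁ hb₁
    refine ⟨F, hF, fun z hzU hzT => ?_⟩
    rw [Finset.mem_insert, not_or] at hzT
    rw [hFeq z hzU hzT.2, hf₁_eq z hzT.1]

/-! ### Local holomorphic sheets over a point with simple fibre roots -/

/-- **Local sheets.** Let `Q ∈ ℚ[ξ][Y]` be monic of degree `d` and let all roots of the fibre
`Q(ξ₀, ·)` be simple. Then there are `ε > 0` and `d` functions `y₁, …, y_d` holomorphic on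
`|ξ - ξ₀| < ε`, pairwise distinct at every point, such that for `|ξ - ξ₀| < ε` the root multiset
of `Q(ξ, ·)` is `{y₁(ξ), …, y_d(ξ)}`. [folklore] -/
theorem exists_localSheets {Q : ℚ[X][X]} (hmonic : Q.Monic) {ξ₀ : ℂ}
    (hsimple : ∀ y : ℂ, (Q.map (eval₂RingHom (algebraMap ℚ ℂ) ξ₀)).IsRoot y →
      ¬ (derivative (Q.map (eval₂RingHom (algebraMap ℚ ℂ) ξ₀))).IsRoot y) :
    ∃ ε > 0, ∃ y : Fin Q.natDegree → ℂ → ℂ,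
      (∀ j, ∀ ξ ∈ ball ξ₀ ε, AnalyticAt ℂ (y j) ξ) ∧
      (∀ ξ ∈ ball ξ₀ ε, Function.Injective fun j => y j ξ) ∧
      (∀ ξ ∈ ball ξ₀ ε, (Q.map (eval₂RingHom (algebraMap ℚ ℂ) ξ)).roots =
        Finset.univ.val.map fun j => y j ξ) := by
  classical
  set d : ℕ := Q.natDegree with hd
  have hfib : ∀ ξ : ℂ, (Q.map (eval₂RingHom (algebraMap ℚ ℂ) ξ)).Monic ∧
      (Q.map (eval₂RingHom (algebraMap ℚ ℂ) ξ)).natDegree = d := fun ξ =>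
    ⟨hmonic.map _, hmonic.natDegree_map _⟩
  have hcard : ∀ ξ : ℂ, Multiset.card (Q.map (eval₂RingHom (algebraMap ℚ ℂ) ξ)).roots = d := by
    intro ξ
    rw [← (hfib ξ).2]
    exact (IsAlgClosed.splits _).natDegree_eq_card_roots.symm
  set P₀ : ℂ[X] := Q.map (eval₂RingHom (algebraMap ℚ ℂ) ξ₀) with hP₀
  have hnodup : P₀.roots.Nodup := by
    rw [Multiset.nodup_iff_count_le_one]
    intro y
    rw [count_roots]
    by_contra h
    have h' := (Polynomial.one_lt_rootMultiplicity_iff_isRoot (hfib ξ₀).1.ne_zero).1 (not_le.1 h)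
    exact hsimple y h'.1 h'.2
  set S₀ : Finset ℂ := P₀.roots.toFinset with hS₀
  have hS₀card : S₀.card = d := by rw [hS₀, Multiset.toFinset_card_of_nodup hnodup, hcard]
  set e : Fin d ≃ S₀ := (Finset.equivFinOfCardEq hS₀card).symm with he
  -- holomorphic root functions through the simple roots
  have hroot : ∀ j : Fin d, ∃ ρ : ℂ → ℂ, ρ ξ₀ = (e j : ℂ) ∧ AnalyticAt ℂ ρ ξ₀ ∧
      ∀ᶠ ξ in 𝓝 ξ₀, (Q.map (eval₂RingHom (algebraMap ℚ ℂ) ξ)).eval (ρ ξ) = 0 := by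
    intro j
    have hmem : ((e j : S₀) : ℂ) ∈ P₀.roots := Multiset.mem_toFinset.1 (e j).2
    have hr : P₀.IsRoot (e j) := (mem_roots (hfib ξ₀).1.ne_zero).1 hmem
    have hr' := hsimple _ hr
    rw [hP₀, derivative_map] at hr'
    exact Literature.FieldTheory.AlgClosed.exists_holomorphic_root Q hr hr'
  choose ρ hρ0 hρa hρz using hroot
  have hev : ∀ᶠ ξ in 𝓝 ξ₀, (∀ j, AnalyticAt ℂ (ρ j) ξ) ∧
      (∀ j, (Q.map (eval₂RingHom (algebraMap ℚ ℂ) ξ)).eval (ρ j ξ) = 0) ∧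
      (∀ j k, j ≠ k → ρ j ξ ≠ ρ k ξ) := by
    refine (eventually_all.2 fun j => (hρa j).eventually_analyticAt).and
      ((eventually_all.2 fun j => hρz j).and ?_)
    refine eventually_all.2 fun j => eventually_all.2 fun k => ?_
    by_cases hjk : j = k
    · exact Eventually.of_forall fun _ h => absurd hjk h
    · have hne : ρ j ξ₀ - ρ k ξ₀ ≠ 0 := by
        rw [hρ0, hρ0, sub_ne_zero]
        exact fun h => hjk (e.injective (Subtype.ext h))
      have hc : ContinuousAt (fun ξ => ρ j ξ - ρ k ξ) ξ₀ :=
        (hρa j).continuousAt.sub (hρa k).continuousAt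
      exact (hc.eventually_ne hne).mono fun ξ h _ => sub_ne_zero.1 h
  obtain ⟨ε, hε, hball⟩ := Metric.eventually_nhds_iff_ball.1 hev
  refine ⟨ε, hε, ρ, fun j ξ hξ => (hball ξ hξ).1 j, fun ξ hξ => fun j k h => ?_, fun ξ hξ => ?_⟩
  · by_contra hjk
    exact (hball ξ hξ).2.2 j k hjk h
  · obtain ⟨-, hz, hdist⟩ := hball ξ hξ
    have hinj : Function.Injective fun j => ρ j ξ := fun j k h => by
      by_contra hjk
      exact hdist j k hjk h
    have h := (Literature.Analysis.Complex.FormalRoot.roots_eq_and_derivative_eval_ne_zero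
      (hfib ξ).1.ne_zero hinj (by rw [(hfib ξ).2, Fintype.card_fin]) fun j => hz j).1
    rw [h, Finset.map_val]
    rfl

end Sheets

end Literature.AlgebraicGeometry.RealAlgebraic
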